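import Literature.AlgebraicGeometry.Resolution.H0InvertibleTimesZeroDimensional
import Literature.AlgebraicGeometry.Resolution.H0CubeIdentity
import Literature.AlgebraicGeometry.Morphisms.CechModuleSixTermLength
import HarnessLib

/-!
# Peeling an invertible factor off a conormal-type quotient:
# `0 → 𝓛𝓗/𝓛𝓗𝓘 → 𝓛/𝓛𝓘 → 𝓛/𝓛(𝓗+𝓘) → 0` and its length identity (Lipman 1969, §13)

Topic: `Literature/AlgebraicGeometry/Resolution`.  PROVED, fact-free, definition-free.  J. Lipman, *Rational
singularities, with applications to algebraic surfaces and unique factorization*, Publ. Math. IHÉS 36 (1969), §13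
(p. 223) computes intersection numbers through the quotients `𝒪(−E)/𝒪(−E−F)` ("`= 𝒪_F ⊗ 𝒪(−E)`") and the
additivity of `χ` along the standard exact sequences of a curve meeting a divisor in finitely many points
(§10–§12, e.g. Remark 2 c) p. 221: "`(𝒪_X(𝒟)·C) = h⁰((i^*𝒟))`").  The ONE exact sequence behind both the step
`F ↦ F + G` (distinct curves) and the twist by a function (`𝓛 ↦ g𝓛`) is, for ideal sheaves `𝓛`, `𝓗`, `𝓘` on a scheme
`X` and the kernels

  `K(𝓐; 𝓑) := ker(𝒪_X/𝓐𝓑 → 𝒪_X/𝓐)`  (the sheaf "`𝓐/𝓐𝓑`", which is `𝓐 ⊗ 𝒪_X/𝓑` for `𝓐` invertible),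

the PEELING sequence

  `0 → K(𝓛𝓗; 𝓘) → K(𝓛; 𝓘) → K(𝓛; 𝓗 + 𝓘) → 0`,

exact as soon as `𝓛𝓗 ∩ 𝓛𝓘 ⊆ 𝓛𝓗𝓘` (e.g. `𝓛` invertible and `𝓗 ∩ 𝓘 = 𝓗𝓘`: two exceptional curves without common
component, or `𝓘 = 𝓘_E` prime and `E ⊄ V(𝓗)`).  When moreover `𝓛` is invertible and `V(𝓗 + 𝓘)` is a finite set of
closed points, the cokernel `K(𝓛; 𝓗+𝓘)` is a skyscraper with `ℓ_T Γ = h⁰(𝒪_X/(𝓗+𝓘))` and `Ȟ¹ = 0`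
(`Resolution/H0InvertibleTimesZeroDimensional` §1), and the six-term Čech sequence
(`Morphisms/CechModuleSixTermLength`) yields the subtraction-free form of
`χ(K(𝓛𝓗; 𝓘)) = χ(K(𝓛; 𝓘)) − h⁰(𝒪/(𝓗+𝓘))`:

  `ℓΓ(K(𝓛𝓗;𝓘)) + h0 π (𝓗 ⊔ 𝓘) + ℓȞ¹(𝒰, K(𝓛;𝓘)) = ℓΓ(K(𝓛;𝓘)) + ℓȞ¹(𝒰, K(𝓛𝓗;𝓘))`.

With `𝓗 = 𝓘_F`, `𝓘 = 𝓘_E` (`E ≠ F` integral exceptional curves, `h⁰(𝒪/(𝓘_F+𝓘_E)) = (F·E)`,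
`Resolution/ExceptionalCurveIntersectionH0`) this is Lipman's `χ(𝒪_E(−L−F)) = χ(𝒪_E(−L)) − (F·E)`; with `𝓗` the
"moving part" of a principal divisor `(g) = a E + H` it is the step `χ(𝒪_E(−L−H)) = χ(𝒪_E(−L)) − (H·E)` of the
computation of the conormal degrees `χ(𝓘_E^n/𝓘_E^{n+1})` (the `η = η′` / repeated-curve halves of Prop. (13.1) b), d)
in `h⁰`-form, `Lipman1969_13_1_b_rat` / `Lipman1969_13_1_d_rat`, NOT proved here).

* §1 the two maps are Mathlib's `kernel.map q₁ q₂ a b _ : K(𝓛𝓗;𝓘) → K(𝓛;𝓘)` and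
  `kernel.map q₂ q₃ c (𝟙 _) _ : K(𝓛;𝓘) → K(𝓛;𝓗+𝓘)` over the commuting squares `kernelPeel_sq₁`, `kernelPeel_sq₂`
  (no new definitions); `mono_kernelPeelMap`, `epi_kernelPeelQuot`, `exact_kernelPeel`, **`shortExact_kernelPeel`**
  (any scheme; hypothesis `𝓛𝓗 ⊓ 𝓛𝓘 ≤ 𝓛𝓗𝓘`);
* §2 `length_MSections_kernel_eq_h0_of_finite_support` — `ℓ_T Γ(X, K(𝓛; 𝓚)) = h0 π 𝓚` for `𝓛` invertible and
  `V(𝓚)` finite (the computation inside `h0_mul_eq_add_of_finite_support`, exported);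
  **`length_kernelPeel`** — the displayed length identity.

## References
* J. Lipman, Publ. Math. IHÉS 36 (1969), §13, Prop. (13.1) b), d) and proof (p. 223); §12 Remark 2 c) (p. 221);
  §10 (p. 212). [Lipman1969]
* R. Hartshorne, *Algebraic Geometry* (1977), II Prop. 5.6, II Ex. 1.17, III Thm. 4.5 (proof, p. 222). [Hartshorne1977]
-/

noncomputable section

-- `TopCat.Presheaf`/`Scheme.Modules` are not reducible (as in Mathlib's `AlgebraicGeometry/Modules`).
set_option backward.isDefEq.respectTransparency false

open CategoryTheory CategoryTheory.Limits AlgebraicGeometry TopologicalSpace IsLocalRing Opposite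
open Literature.AlgebraicGeometry.Morphisms Literature.AlgebraicGeometry.Modules
open Literature.AlgebraicGeometry.Motives
open Scheme.IdealSheafData

universe u

namespace Literature.AlgebraicGeometry.Resolution

variable {T : Type u} [CommRing T] {X : Scheme.{u}} (π : X ⟶ Spec (.of T))

/-- `(φ ≫ ψ)_V(x) = ψ_V(φ_V(x))` on sections of `𝒪_X`-modules. [folklore] -/
private theorem comp_app_apply' {M N P : X.Modules} (φ : M ⟶ N) (ψ : N ⟶ P) (V : X.Opens) (x : Γ(M, V)) :
    (φ ≫ ψ).app V x = ψ.app V (φ.app V x) := by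
  rw [Scheme.Modules.Hom.comp_app, CategoryTheory.comp_apply]

/-! ## §1 The peeling sequence `0 → 𝓛𝓗/𝓛𝓗𝓘 → 𝓛/𝓛𝓘 → 𝓛/𝓛(𝓗+𝓘) → 0` -/

section Peel

variable (𝓛 𝓗 𝓘 : X.IdealSheafData)
  (q₁ : idealQuot (unitModule X) (𝓛 * 𝓗 * 𝓘) ⟶ idealQuot (unitModule X) (𝓛 * 𝓗))
  (q₂ : idealQuot (unitModule X) (𝓛 * 𝓘) ⟶ idealQuot (unitModule X) 𝓛)
  (q₃ : idealQuot (unitModule X) (𝓛 * (𝓗 ⊔ 𝓘)) ⟶ idealQuot (unitModule X) 𝓛)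
  (hq₁ : idealQuotπ (unitModule X) (𝓛 * 𝓗 * 𝓘) ≫ q₁ = idealQuotπ (unitModule X) (𝓛 * 𝓗))
  (hq₂ : idealQuotπ (unitModule X) (𝓛 * 𝓘) ≫ q₂ = idealQuotπ (unitModule X) 𝓛)
  (hq₃ : idealQuotπ (unitModule X) (𝓛 * (𝓗 ⊔ 𝓘)) ≫ q₃ = idealQuotπ (unitModule X) 𝓛)
  (a : idealQuot (unitModule X) (𝓛 * 𝓗 * 𝓘) ⟶ idealQuot (unitModule X) (𝓛 * 𝓘))
  (ha : idealQuotπ (unitModule X) (𝓛 * 𝓗 * 𝓘) ≫ a = idealQuotπ (unitModule X) (𝓛 * 𝓘))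
  (b : idealQuot (unitModule X) (𝓛 * 𝓗) ⟶ idealQuot (unitModule X) 𝓛)
  (hb : idealQuotπ (unitModule X) (𝓛 * 𝓗) ≫ b = idealQuotπ (unitModule X) 𝓛)
  (c : idealQuot (unitModule X) (𝓛 * 𝓘) ⟶ idealQuot (unitModule X) (𝓛 * (𝓗 ⊔ 𝓘)))
  (hc : idealQuotπ (unitModule X) (𝓛 * 𝓘) ≫ c = idealQuotπ (unitModule X) (𝓛 * (𝓗 ⊔ 𝓘)))
  (w₁ : q₁ ≫ b = a ≫ q₂) (w₂ : q₂ ≫ 𝟙 _ = c ≫ q₃)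

include hq₁ hq₂ ha hb in
/-- The square `𝒪/𝓛𝓗𝓘 → 𝒪/𝓛𝓗 → 𝒪/𝓛` = `𝒪/𝓛𝓗𝓘 → 𝒪/𝓛𝓘 → 𝒪/𝓛` commutes (both are the projection).
[cite: Hartshorne1977, II Prop. 5.6 (p. 113)] -/
theorem kernelPeel_sq₁ : q₁ ≫ b = a ≫ q₂ := by
  apply idealQuot_hom_ext
  rw [← Category.assoc, hq₁, hb, ← Category.assoc, ha, hq₂]

include hq₂ hq₃ hc in
/-- The square `𝒪/𝓛𝓘 → 𝒪/𝓛` = `𝒪/𝓛𝓘 → 𝒪/𝓛(𝓗+𝓘) → 𝒪/𝓛` commutes. [cite: Hartshorne1977, II Prop. 5.6 (p. 113)] -/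
theorem kernelPeel_sq₂ : q₂ ≫ 𝟙 _ = c ≫ q₃ := by
  apply idealQuot_hom_ext
  rw [Category.comp_id, hq₂, ← Category.assoc, hc, hq₃]

/-- Sections of the PEELING MAP `f = kernel.map q₁ q₂ a b _ : 𝓛𝓗/𝓛𝓗𝓘 → 𝓛/𝓛𝓘` (induced by `𝒪/𝓛𝓗𝓘 → 𝒪/𝓛𝓘`
over `𝒪/𝓛𝓗 → 𝒪/𝓛`): `ι(f s) = a(ι s)`. [cite: Lipman1969, Section 13 (p. 223)] -/
theorem kernel_ι_app_kernelPeelMap_app (V : X.Opens) (s : Γ(kernel q₁, V)) :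
    (kernel.ι q₂).app V ((kernel.map q₁ q₂ a b w₁).app V s) = a.app V ((kernel.ι q₁).app V s) := by
  rw [← comp_app_apply', kernel.lift_ι, comp_app_apply']

/-- Sections of the PEELING QUOTIENT `g = kernel.map q₂ q₃ c (𝟙 _) _ : 𝓛/𝓛𝓘 → 𝓛/𝓛(𝓗+𝓘)` (induced by
`𝒪/𝓛𝓘 → 𝒪/𝓛(𝓗+𝓘)` over `𝒪/𝓛`): `ι(g s) = c(ι s)`. [cite: Lipman1969, Section 13 (p. 223)] -/
theorem kernel_ι_app_kernelPeelQuot_app (V : X.Opens) (s : Γ(kernel q₂, V)) :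
    (kernel.ι q₃).app V ((kernel.map q₂ q₃ c (𝟙 _) w₂).app V s) = c.app V ((kernel.ι q₂).app V s) := by
  rw [← comp_app_apply', kernel.lift_ι, comp_app_apply']

include hq₁ ha hc in
/-- **`K(𝓛𝓗;𝓘) → K(𝓛;𝓘) → K(𝓛;𝓗+𝓘)` is zero**: `𝒪/𝓛𝓗𝓘 → 𝒪/𝓛𝓘 → 𝒪/𝓛(𝓗+𝓘)` factors through `𝒪/𝓛𝓗`
(`𝓛𝓗𝓘 ≤ 𝓛𝓗 ≤ 𝓛(𝓗+𝓘)`), on whose kernel it vanishes. [cite: Lipman1969, Section 13 (p. 223)] -/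
theorem kernelPeelMap_comp_kernelPeelQuot :
    kernel.map q₁ q₂ a b w₁ ≫ kernel.map q₂ q₃ c (𝟙 _) w₂ = 0 := by
  -- `d : 𝒪/𝓛𝓗 → 𝒪/𝓛(𝓗+𝓘)` with `a ≫ c = q₁ ≫ d`
  have hle : 𝓛 * 𝓗 ≤ 𝓛 * (𝓗 ⊔ 𝓘) := by
    intro U
    rw [ideal_mul, ideal_mul, Pi.mul_apply, Pi.mul_apply, ideal_sup, Pi.sup_apply]
    exact Ideal.mul_mono_right le_sup_left
  let d : idealQuot (unitModule X) (𝓛 * 𝓗) ⟶ idealQuot (unitModule X) (𝓛 * (𝓗 ⊔ 𝓘)) :=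
    idealQuotDesc ((isKilledBy_idealQuot (unitModule X) (𝓛 * (𝓗 ⊔ 𝓘))).anti hle) (idealQuotπ _ _)
  have hd : idealQuotπ (unitModule X) (𝓛 * 𝓗) ≫ d = idealQuotπ (unitModule X) (𝓛 * (𝓗 ⊔ 𝓘)) :=
    idealQuotπ_desc _ _
  have hac : a ≫ c = q₁ ≫ d := by
    apply idealQuot_hom_ext
    rw [← Category.assoc, ha, hc, ← Category.assoc, hq₁, hd]
  rw [← cancel_mono (kernel.ι q₃), Category.assoc, kernel.lift_ι, ← Category.assoc, kernel.lift_ι,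
    Category.assoc, hac, ← Category.assoc, kernel.condition, zero_comp, zero_comp]

include hq₁ ha in
/-- **`K(𝓛𝓗;𝓘) → K(𝓛;𝓘)` is a monomorphism when `𝓛𝓗 ∩ 𝓛𝓘 ⊆ 𝓛𝓗𝓘`** (on an affine `V`: a function in
`(𝓛𝓗)(V)` lying in `(𝓛𝓘)(V)` lies in `(𝓛𝓗𝓘)(V)`). [cite: Lipman1969, Section 13 (p. 223)] -/
theorem mono_kernelPeelMap (hLHI : 𝓛 * 𝓗 ⊓ 𝓛 * 𝓘 ≤ 𝓛 * 𝓗 * 𝓘) : Mono (kernel.map q₁ q₂ a b w₁) := by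
  refine mono_of_injective_app_of_isAffineOpen _ fun V hV => ?_
  intro s s' hss'
  rw [← sub_eq_zero]
  rw [← sub_eq_zero, ← map_sub] at hss'
  generalize s - s' = t at hss' ⊢
  apply kernel_ι_app_injective q₁ V
  rw [map_zero]
  obtain ⟨c₀, hc₀⟩ := idealQuotπ_unit_app_surjective (𝓛 * 𝓗 * 𝓘) hV ((kernel.ι q₁).app V t)
  -- `c₀ ∈ (𝓛𝓗)(V)` since `q₁(ι t) = 0`
  have h1 : (c₀ : Γ(X, V)) ∈ (𝓛 * 𝓗).ideal ⟨V, hV⟩ := by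
    rw [← idealQuotπ_unit_app_eq_zero_iff _ hV, ← app_idealQuotπ_app_of_comp_eq hq₁ V c₀, hc₀]
    exact app_kernel_ι_app q₁ V t
  -- `c₀ ∈ (𝓛𝓘)(V)` since `a(ι t) = ι(f t) = 0`
  have h2 : (c₀ : Γ(X, V)) ∈ (𝓛 * 𝓘).ideal ⟨V, hV⟩ := by
    rw [← idealQuotπ_unit_app_eq_zero_iff _ hV, ← app_idealQuotπ_app_of_comp_eq ha V c₀, hc₀,
      ← kernel_ι_app_kernelPeelMap_app _ _ _ q₁ q₂ a b w₁ V t, hss', map_zero]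
  have h3 : (c₀ : Γ(X, V)) ∈ (𝓛 * 𝓗 * 𝓘).ideal ⟨V, hV⟩ := by
    apply hLHI ⟨V, hV⟩
    rw [ideal_inf]
    exact ⟨h1, h2⟩
  rw [← hc₀, idealQuotπ_unit_app_eq_zero_iff _ hV]
  exact h3

include hq₂ hq₃ hc in
/-- **`K(𝓛;𝓘) → K(𝓛;𝓗+𝓘)` is an epimorphism** (on an affine `V` a section of `K(𝓛;𝓗+𝓘)` is the class of
some `c₀ ∈ 𝓛(V)`, which also defines a section of `K(𝓛;𝓘)`). [cite: Lipman1969, Section 13 (p. 223)] -/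
theorem epi_kernelPeelQuot : Epi (kernel.map q₂ q₃ c (𝟙 _) w₂) := by
  refine epi_of_surjective_app_of_isAffineOpen _ fun V hV => ?_
  intro w
  obtain ⟨c₀, hc₀⟩ := idealQuotπ_unit_app_surjective (𝓛 * (𝓗 ⊔ 𝓘)) hV ((kernel.ι q₃).app V w)
  have h1 : (c₀ : Γ(X, V)) ∈ 𝓛.ideal ⟨V, hV⟩ := by
    rw [← idealQuotπ_unit_app_eq_zero_iff _ hV, ← app_idealQuotπ_app_of_comp_eq hq₃ V c₀, hc₀]
    exact app_kernel_ι_app q₃ V w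
  -- the section of `K(𝓛;𝓘)` defined by `c₀`
  have h2 : q₂.app V ((idealQuotπ (unitModule X) (𝓛 * 𝓘)).app V c₀) = 0 := by
    rw [app_idealQuotπ_app_of_comp_eq hq₂ V c₀, idealQuotπ_unit_app_eq_zero_iff _ hV]
    exact h1
  obtain ⟨s, hs⟩ := exists_kernel_ι_app_eq q₂ V _ h2
  refine ⟨s, ?_⟩
  apply kernel_ι_app_injective q₃ V
  rw [kernel_ι_app_kernelPeelQuot_app, hs, app_idealQuotπ_app_of_comp_eq hc V c₀, hc₀]

include hq₁ ha hc in
/-- **Exactness of `K(𝓛𝓗;𝓘) → K(𝓛;𝓘) → K(𝓛;𝓗+𝓘)` in the middle** (on an affine `W`: a section of `K(𝓛;𝓘)` is the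
class of `c₀ ∈ 𝓛(W)`; if it dies in `𝒪/𝓛(𝓗+𝓘)` then `c₀ ∈ 𝓛(W)(𝓗(W)+𝓘(W)) = (𝓛𝓗)(W) + (𝓛𝓘)(W)`, `c₀ = y + z`,
and the class of `c₀` mod `𝓛𝓘` is that of `y ∈ (𝓛𝓗)(W)`, a section of `K(𝓛𝓗;𝓘)`).
[cite: Lipman1969, Section 13 (p. 223)] [cite: Hartshorne1977, II Prop. 5.6 (p. 113)] -/
theorem exact_kernelPeel :
    (ShortComplex.mk (kernel.map q₁ q₂ a b w₁) (kernel.map q₂ q₃ c (𝟙 _) w₂)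
      (kernelPeelMap_comp_kernelPeelQuot 𝓛 𝓗 𝓘 q₁ q₂ q₃ hq₁ a ha b c hc w₁ w₂)).Exact := by
  refine exact_of_locally_exact _ fun V s hs x hx => ?_
  obtain ⟨W, hW, hxW, hWV⟩ := Opens.isBasis_iff_nbhd.mp X.isBasis_affineOpens hx
  refine ⟨W, homOfLE hWV, hxW, ?_⟩
  -- restrict to the affine `W`
  set s' : Γ(kernel q₂, W) := (kernel q₂).presheaf.map (homOfLE hWV).op s with hs'
  have hs'0 : (kernel.map q₂ q₃ c (𝟙 _) w₂).app W s' = 0 := by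
    have hnat : (kernel.map q₂ q₃ c (𝟙 _) w₂).app W ((kernel q₂).presheaf.map (homOfLE hWV).op s) =
        (kernel q₃).presheaf.map (homOfLE hWV).op ((kernel.map q₂ q₃ c (𝟙 _) w₂).app V s) :=
      ConcreteCategory.congr_hom ((kernel.map q₂ q₃ c (𝟙 _) w₂).mapPresheaf.naturality (homOfLE hWV).op) s
    rw [hs', hnat, show (kernel.map q₂ q₃ c (𝟙 _) w₂).app V s = 0 from hs, map_zero]
  -- `ι s'` is the class of some `c₀ ∈ 𝓛(W)` with `c₀ ∈ (𝓛(𝓗+𝓘))(W)`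
  obtain ⟨c₀, hc₀⟩ := idealQuotπ_unit_app_surjective (𝓛 * 𝓘) hW ((kernel.ι q₂).app W s')
  have hmem : (c₀ : Γ(X, W)) ∈ (𝓛 * (𝓗 ⊔ 𝓘)).ideal ⟨W, hW⟩ := by
    rw [← idealQuotπ_unit_app_eq_zero_iff _ hW, ← app_idealQuotπ_app_of_comp_eq hc W c₀, hc₀,
      ← kernel_ι_app_kernelPeelQuot_app _ _ _ q₂ q₃ c w₂ W s', hs'0, map_zero]
  have hmem' : (c₀ : Γ(X, W)) ∈ (𝓛 * 𝓗).ideal ⟨W, hW⟩ ⊔ (𝓛 * 𝓘).ideal ⟨W, hW⟩ := by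
    rw [ideal_mul, Pi.mul_apply, ideal_sup, Pi.sup_apply, Ideal.mul_sup] at hmem
    rw [ideal_mul, ideal_mul, Pi.mul_apply, Pi.mul_apply]
    exact hmem
  obtain ⟨y, hy, z, hz, hyz⟩ := Submodule.mem_sup.mp hmem'
  set y' : Γ(unitModule X, W) := y with hy'
  set z' : Γ(unitModule X, W) := z with hz'
  -- the section `t` of `K(𝓛𝓗;𝓘)` defined by `y`
  have hq₁y : q₁.app W ((idealQuotπ (unitModule X) (𝓛 * 𝓗 * 𝓘)).app W y') = 0 := by
    rw [app_idealQuotπ_app_of_comp_eq hq₁ W y', idealQuotπ_unit_app_eq_zero_iff _ hW]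
    exact hy
  obtain ⟨t, ht⟩ := exists_kernel_ι_app_eq q₁ W _ hq₁y
  refine ⟨t, ?_⟩
  change (kernel.map q₁ q₂ a b w₁).app W t = s'
  apply kernel_ι_app_injective q₂ W
  rw [kernel_ι_app_kernelPeelMap_app, ht, app_idealQuotπ_app_of_comp_eq ha W y', ← hc₀]
  -- `y ≡ c₀ (mod 𝓛𝓘)` since `c₀ = y + z`, `z ∈ (𝓛𝓘)(W)`
  have e : c₀ = y' + z' := hyz.symm
  rw [e, map_add, left_eq_add, idealQuotπ_unit_app_eq_zero_iff _ hW]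
  exact hz

include hq₁ hq₂ hq₃ ha hc in
/-- **The peeling short exact sequence `0 → 𝓛𝓗/𝓛𝓗𝓘 → 𝓛/𝓛𝓘 → 𝓛/𝓛(𝓗+𝓘) → 0`** of `𝒪_X`-modules (kernels
`K(𝓐;𝓑) = ker(𝒪/𝓐𝓑 → 𝒪/𝓐)`), for ideal sheaves with `𝓛𝓗 ∩ 𝓛𝓘 ⊆ 𝓛𝓗𝓘` on any scheme — Lipman's
`0 → 𝒪_E(−L−F) → 𝒪_E(−L) → 𝒪_{E∩F}(−L) → 0` / `0 → 𝒪_E(−L−H) → 𝒪_E(−L) → 𝒪_{E∩H} → 0` written with ideals.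
[cite: Lipman1969, Section 13 (p. 223)] [cite: Hartshorne1977, II Prop. 5.6 (p. 113)] -/
theorem shortExact_kernelPeel (hLHI : 𝓛 * 𝓗 ⊓ 𝓛 * 𝓘 ≤ 𝓛 * 𝓗 * 𝓘) :
    (ShortComplex.mk (kernel.map q₁ q₂ a b w₁) (kernel.map q₂ q₃ c (𝟙 _) w₂)
      (kernelPeelMap_comp_kernelPeelQuot 𝓛 𝓗 𝓘 q₁ q₂ q₃ hq₁ a ha b c hc w₁ w₂)).ShortExact :=
  haveI := mono_kernelPeelMap 𝓛 𝓗 𝓘 q₁ q₂ hq₁ a ha b w₁ hLHI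
  haveI := epi_kernelPeelQuot 𝓛 𝓗 𝓘 q₂ q₃ hq₂ hq₃ c hc w₂
  ShortComplex.ShortExact.mk' (exact_kernelPeel 𝓛 𝓗 𝓘 q₁ q₂ q₃ hq₁ a ha b c hc w₁ w₂)
    inferInstance inferInstance

/-- The mono hypothesis from an invertible `𝓛` and `𝓗 ∩ 𝓘 ⊆ 𝓗𝓘` (`𝓛(𝓗 ∩ 𝓘) = 𝓛𝓗 ∩ 𝓛𝓘`, `X` integral).
[cite: GortzWedhorn2020, Thm. 11.40] -/
theorem mul_inf_mul_le_of_isEffectiveCartier [IsIntegral X] (hL : IsEffectiveCartier 𝓛) (hHI : 𝓗 ⊓ 𝓘 ≤ 𝓗 * 𝓘) :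
    𝓛 * 𝓗 ⊓ 𝓛 * 𝓘 ≤ 𝓛 * 𝓗 * 𝓘 := by
  rw [← mul_inf_eq_of_isEffectiveCartier 𝓛 𝓗 𝓘 hL, mul_assoc]
  exact fun U => by
    rw [ideal_mul, ideal_mul, Pi.mul_apply, Pi.mul_apply]
    exact Ideal.mul_mono_right (hHI U)

end Peel

/-! ## §2 The length identity -/

section Length

variable [IsIntegral X]

/-- **Charts adapted to `𝓛` and `Z`**: for an invertible ideal sheaf `𝓛`, a finite set `Z` of closed points and
`p : X`, an affine open `U ∋ p` meeting `Z` at most in `p`, on which `𝓛(U) = (t)` with `t` a non-zero-divisor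
(a basic open of a Cartier chart of `𝓛` at `p`; as in `Resolution/H0InvertibleTimesZeroDimensional`). [folklore] -/
private theorem exists_cartier_chart_isolating' (𝓛 : X.IdealSheafData) (hL : IsEffectiveCartier 𝓛) {Z : Set X}
    (hZ : Z.Finite) (hZcl : ∀ p ∈ Z, IsClosed ({p} : Set X)) (p : X) :
    ∃ (U : X.Opens) (hU : IsAffineOpen U), p ∈ U ∧ (∀ q ∈ Z, q ∈ U → q = p) ∧
      ∃ t : Γ(X, U), 𝓛.ideal ⟨U, hU⟩ = Ideal.span {t} ∧ t ∈ nonZeroDivisors Γ(X, U) := by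
  have hcl : IsClosed (Z \ {p}) := by
    have hsub : Z \ {p} ⊆ Z := fun q hq => hq.1
    have h := (hZ.subset hsub).isClosed_biUnion fun q (hq : q ∈ Z \ {p}) => hZcl q hq.1
    rwa [Set.biUnion_of_singleton] at h
  set W : X.Opens := ⟨(Z \ {p})ᶜ, hcl.isOpen_compl⟩ with hW
  have hpW : p ∈ W := fun h => h.2 rfl
  set V := CartierDivisor.cartierChart 𝓛 hL p with hV
  obtain ⟨f, hfW, hpf⟩ := V.2.exists_basicOpen_le ⟨p, hpW⟩ (CartierDivisor.mem_cartierChart 𝓛 hL p)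
  refine ⟨X.basicOpen f, V.2.basicOpen f, hpf, fun q hq hqU => ?_, ?_⟩
  · by_contra hqp
    exact hfW hqU ⟨hq, hqp⟩
  · set t := X.presheaf.map (homOfLE (X.basicOpen_le f)).op (CartierDivisor.cartierGen 𝓛 hL p) with ht
    refine ⟨t, ?_, ?_⟩
    · have h := 𝓛.map_ideal_basicOpen V f
      rw [CartierDivisor.ideal_cartierChart, Ideal.map_span, Set.image_singleton] at h
      exact h.symm
    · haveI : Nonempty (X.basicOpen f : X.Opens) := ⟨⟨p, hpf⟩⟩
      refine mem_nonZeroDivisors_of_ne_zero fun h0 => CartierDivisor.cartierGen_ne_zero 𝓛 hL p ?_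
      apply AlgebraicGeometry.germ_injective_of_isIntegral (X := X) p (CartierDivisor.mem_cartierChart 𝓛 hL p)
      rw [map_zero, ← TopCat.Presheaf.germ_res_apply X.presheaf (homOfLE (X.basicOpen_le f)) p hpf, ← ht, h0,
        map_zero]

/-- **`ℓ_T Γ(X, 𝓛/𝓛𝓚) = h⁰(𝒪_X/𝓚)` for `𝓛` invertible and `V(𝓚)` a finite set of closed points** (`𝓛/𝓛𝓚 ≅ 𝒪/𝓚`
near each point of `V(𝓚)`; `Γ` of a finitely supported sheaf is the product of the local sections). This is the
computation inside `h0_mul_eq_add_of_finite_support`, exported for the kernel `K(𝓛;𝓚) = ker(𝒪/𝓛𝓚 → 𝒪/𝓛)`.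
[cite: Lipman1969, Section 12, Remark 2 c) (p. 221)] [cite: Hartshorne1977, II Ex. 1.17] -/
theorem length_MSections_kernel_eq_h0_of_finite_support [CompactSpace X] (𝓛 𝓚 : X.IdealSheafData)
    (hL : IsEffectiveCartier 𝓛)
    (q : idealQuot (unitModule X) (𝓛 * 𝓚) ⟶ idealQuot (unitModule X) 𝓛)
    (hq : idealQuotπ (unitModule X) (𝓛 * 𝓚) ≫ q = idealQuotπ (unitModule X) 𝓛)
    {Z : Set X} (hZ : Z.Finite) (hZcl : ∀ p ∈ Z, IsClosed ({p} : Set X)) (hsupp : (𝓚.support : Set X) ⊆ Z) :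
    Module.length T (MSections π (kernel q) ⊤) = h0 π 𝓚 := by
  classical
  choose U hUaff hpU hU' t ht ht0 using fun p : X => exists_cartier_chart_isolating' (X := X) 𝓛 hL hZ hZcl p
  have hsuppK : ∀ W : X.Opens, Disjoint (W : Set X) Z → ∀ s : MSections π (kernel q) W, s = 0 :=
    fun W hW s => kernel_sections_eq_zero_of_disjoint π 𝓛 𝓚 q hq W (hW.mono_right hsupp) s
  letI := hZ.fintype
  rw [MSections.length_top_eq_sum_of_finite_support π (kernel q) hZcl hsuppK U (fun p _ => hpU p)
      (fun p _ q hq hq' => hU' p q hq hq') hZ,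
    h0_eq_sum_length_quotient_of_support_subset π 𝓚 hZ hZcl hsupp U (fun p _ => hUaff p) (fun p _ => hpU p)
      fun p _ q hq hq' => hU' p q hq hq']
  exact Fintype.sum_congr _ _ fun p =>
    length_kernel_sections_eq_length_quotient π 𝓛 𝓚 q hq (hUaff p.1) (t p.1) (ht p.1) (ht0 p.1)

variable (𝓛 𝓗 𝓘 : X.IdealSheafData)
  (q₁ : idealQuot (unitModule X) (𝓛 * 𝓗 * 𝓘) ⟶ idealQuot (unitModule X) (𝓛 * 𝓗))
  (q₂ : idealQuot (unitModule X) (𝓛 * 𝓘) ⟶ idealQuot (unitModule X) 𝓛)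
  (q₃ : idealQuot (unitModule X) (𝓛 * (𝓗 ⊔ 𝓘)) ⟶ idealQuot (unitModule X) 𝓛)
  (hq₁ : idealQuotπ (unitModule X) (𝓛 * 𝓗 * 𝓘) ≫ q₁ = idealQuotπ (unitModule X) (𝓛 * 𝓗))
  (hq₂ : idealQuotπ (unitModule X) (𝓛 * 𝓘) ≫ q₂ = idealQuotπ (unitModule X) 𝓛)
  (hq₃ : idealQuotπ (unitModule X) (𝓛 * (𝓗 ⊔ 𝓘)) ≫ q₃ = idealQuotπ (unitModule X) 𝓛)
  (a : idealQuot (unitModule X) (𝓛 * 𝓗 * 𝓘) ⟶ idealQuot (unitModule X) (𝓛 * 𝓘))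
  (ha : idealQuotπ (unitModule X) (𝓛 * 𝓗 * 𝓘) ≫ a = idealQuotπ (unitModule X) (𝓛 * 𝓘))
  (b : idealQuot (unitModule X) (𝓛 * 𝓗) ⟶ idealQuot (unitModule X) 𝓛)
  (c : idealQuot (unitModule X) (𝓛 * 𝓘) ⟶ idealQuot (unitModule X) (𝓛 * (𝓗 ⊔ 𝓘)))
  (hc : idealQuotπ (unitModule X) (𝓛 * 𝓘) ≫ c = idealQuotπ (unitModule X) (𝓛 * (𝓗 ⊔ 𝓘)))
  (w₁ : q₁ ≫ b = a ≫ q₂) (w₂ : q₂ ≫ 𝟙 _ = c ≫ q₃)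

include q₃ hq₁ hq₂ hq₃ a ha b c hc w₁ w₂ in
/-- **The peeling length identity** `ℓΓ(𝓛𝓗/𝓛𝓗𝓘) + h⁰(𝒪/(𝓗+𝓘)) + ℓȞ¹(𝒰, 𝓛/𝓛𝓘) = ℓΓ(𝓛/𝓛𝓘) + ℓȞ¹(𝒰, 𝓛𝓗/𝓛𝓗𝓘)`
— the subtraction-free form of `χ(𝓛𝓗/𝓛𝓗𝓘) = χ(𝓛/𝓛𝓘) − h⁰(𝒪/(𝓗+𝓘))` — on a quasi-compact integral `T`-scheme,
for `𝓛` invertible, `𝓛𝓗 ∩ 𝓛𝓘 ⊆ 𝓛𝓗𝓘`, `V(𝓗+𝓘)` a finite set of closed points, and any finite affine open cover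
`𝒰` (six-term Čech sequence of the peeling short exact sequence; its cokernel `𝓛/𝓛(𝓗+𝓘)` has
`ℓΓ = h⁰(𝒪/(𝓗+𝓘))` and `Ȟ¹ = 0`). For `𝓗 = 𝓘_F`, `𝓘 = 𝓘_E` (distinct integral exceptional curves) this is Lipman's
`χ(𝒪_E(−L−F)) = χ(𝒪_E(−L)) − (F·E)`; for `𝓗` the moving part of a principal divisor `(g) = aE + H` it is
`χ(𝒪_E(−L−H)) = χ(𝒪_E(−L)) − (H·E)`. [cite: Lipman1969, Section 13 (p. 223) with Section 12 Remark 2 c) (p. 221)]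
[cite: Hartshorne1977, III Thm. 4.5 proof p. 222 (long exact sequence of Čech cohomology)] -/
theorem length_kernelPeel [CompactSpace X] (hL : IsEffectiveCartier 𝓛) (hLHI : 𝓛 * 𝓗 ⊓ 𝓛 * 𝓘 ≤ 𝓛 * 𝓗 * 𝓘)
    {Z : Set X} (hZ : Z.Finite) (hZcl : ∀ p ∈ Z, IsClosed ({p} : Set X))
    (hsupp : ((𝓗 ⊔ 𝓘).support : Set X) ⊆ Z)
    {κ : Type u} [Finite κ] (U : κ → X.Opens) (hUaff : ∀ i, IsAffineOpen (U i)) (hUcov : ⨆ i, U i = ⊤) :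
    Module.length T (MSections π (kernel q₁) ⊤) + h0 π (𝓗 ⊔ 𝓘) + Module.length T (CechMH1 π (kernel q₂) U) =
      Module.length T (MSections π (kernel q₂) ⊤) + Module.length T (CechMH1 π (kernel q₁) U) := by
  have hT := shortExact_kernelPeel 𝓛 𝓗 𝓘 q₁ q₂ q₃ hq₁ hq₂ hq₃ a ha b c hc w₁ w₂ hLHI
  have hK₁ : IsAffineLocalizing (kernel q₁) :=
    IsAffineLocalizing.kernel q₁ (isAffineLocalizing_idealQuot _ IsAffineLocalizing.unit)
      (isAffineLocalizing_idealQuot _ IsAffineLocalizing.unit)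
  have hdata : CechExactData π U (kernel.map q₁ q₂ a b w₁) (kernel.map q₂ q₃ c (𝟙 _) w₂) :=
    CechExactData.of_shortExact π U hT hK₁ hUaff
  -- the cokernel is a skyscraper: `Ȟ¹ = 0`, `ℓΓ = h0 (𝓗 ⊔ 𝓘)`
  have hsuppK₃ : ∀ W : X.Opens, Disjoint (W : Set X) Z → ∀ s : MSections π (kernel q₃) W, s = 0 :=
    fun W hW s => kernel_sections_eq_zero_of_disjoint π 𝓛 (𝓗 ⊔ 𝓘) q₃ hq₃ W (hW.mono_right hsupp) s
  haveI hH1 : Subsingleton (CechMH1 π (kernel q₃) U) :=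
    CechMH1.subsingleton_of_finite_support π _ U hZ hZcl hsuppK₃
  have hsurj : Function.Surjective (cechMapH1 π (kernel.map q₂ q₃ c (𝟙 _) w₂) U) :=
    fun y => ⟨0, Subsingleton.elim _ _⟩
  have hsix := CechExactData.length_cechMH0_add π U hdata hsurj
  have e3 : Module.length T (CechMH1 π (kernel q₃) U) = 0 := Module.length_eq_zero
  have hΓ₃ : Module.length T (MSections π (kernel q₃) ⊤) = h0 π (𝓗 ⊔ 𝓘) :=
    length_MSections_kernel_eq_h0_of_finite_support π 𝓛 (𝓗 ⊔ 𝓘) hL q₃ hq₃ hZ hZcl hsupp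
  rw [e3, add_zero, ← (cechMH0EquivSections π U (kernel q₁) hUcov).length_eq,
    ← (cechMH0EquivSections π U (kernel q₂) hUcov).length_eq,
    ← (cechMH0EquivSections π U (kernel q₃) hUcov).length_eq, hΓ₃] at hsix
  exact hsix

end Length

end Literature.AlgebraicGeometry.Resolution

end
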